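import Summits.BirchSwinnertonDyer.BirchSwinnertonDyer.Theorems.ByReductionTypeAtTwoAnalyticMuCertificateLemmas
import Literature.NumberTheory.EllipticCurves.PAdicLFunctionIntegralityAtTwoAutoProofs
import HarnessLib

/-!
# Route `ByReductionTypeAtTwo` (K4), TOWER road / shared μ₂-supply target — the `μ = 0` CERTIFICATE AT `p = 2`:
# a UNIT doubled value `2·μ_{f,α}(5ˢ + 2ⁿ⁺²ℤ₂)` forces a UNIT coefficient of `L₂(f, α, T)` below degree `2ⁿ`

Cell `bsd-2adic`, seat `bsd-2adic-tower-1` (GEN 24), `--supports stmt-BirchSwinnertonDyer-19271` (helper; brick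
P4 of the kernel road «analytic `μ = 0` at `2` on {good ordinary at `2`, `E[2]` irreducible}» — planner RC-250
stub S3 «dictionary D2 / CollapseAtTwo», coefficient half).  Theorems only; no definition, no named fact, no
`sorry`.

## What

`PAdicLFunctionMuInvariantCertificateProofs` (cell bsd-print-x9) proves for ANY prime `p` the abstract
certificate «one Teichmüller-orbit sum beats `C·p⁻¹` ⟹ some coefficient beats `C·p⁻¹`», `C` a bound on the
measure `μ`.  At `p = 2` the Mazur–Swinnerton-Dyer measure `μ_{f,α}` is only `½ℤ₂`-valued (`C = 2`,
`norm_msdMeasure_two_le_two_auto`), so that statement is EMPTY there (`C·2⁻¹ = 1`, but the orbit sums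
`μ(5ˢ) + μ(−5ˢ) = 2μ(5ˢ)` are `2`-integral).  The cure is to run the same two steps — Newton inversion below
degree `2ⁿ` and the Lucas congruence of the Riemann sums — on the `γ`-EXPONENT LINE with the DOUBLED values
`ν_n(s) := 2·μ_{f,α}(5ˢ + 2ⁿ⁺²ℤ₂)` (`‖ν‖ ≤ 1`), whose Riemann sums ARE the tree's
(`padicLRiemannSum_two`: `RS(k,n) = ∑_s ν_n(s)·(s choose k)`) and which satisfy the distribution relation on the
tower `(ℤ/2ⁿ)_n` (`sum_fiber_orbitSum_succ_eq` + `orbitSum_two_eq`):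

* `orbitSum_two_eq` — the Teichmüller-orbit sum at `2` IS `2μ(5ˢ)` (`Δ = {±1}`, `msdMeasure_neg`);
* `exists_orbit_eq_of_odd` — every ODD class mod `2ⁿ⁺²` is `±5ˢ`, so its measure is an orbit value
  (`classMap` bijection of `PAdicLFunctionInterpolationProofs`);
* `norm_padicLRiemannSum_two_sub_le_half` — `‖RS(k,m) − RS(k,n)‖₂ ≤ ½` for `k < 2ⁿ ≤ 2ᵐ` (Lucas);
* **`exists_norm_padicLCoeff_two_eq_one_of_orbit`** — a unit `ν_n(s₀)` ⟹ some `‖c_k‖₂ = 1`, `k < 2ⁿ`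
  (given the coefficient bound `‖c_k‖ ≤ 1`, INT2-AUTO);
* `exists_norm_padicLCoeff_two_eq_one_of_odd` — the same from a unit `2μ` at an odd class (input shape of
  `ByReductionTypeAtTwoAnalyticMuCollapse.exists_odd_norm_two_mul_msdMeasure_eq_one`).

HONEST FRAMING: nothing about any curve is asserted; MTT folklore made kernel at `p = 2` (the odd-`p` twin is
bsd-print-x9's; Newton inversion and Lucas are its private lemmas re-run in part 1/2
`ByReductionTypeAtTwoAnalyticMuCertificateLemmas`, credit there); beyond-print: no.  BSD is not proved by any
of this.

References: [MazurTateTeitelbaum1986Invent] §I.10 (10.1), §I.11–I.13; [Washington1997] §7.2;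
[GreenbergVatsal2000] (2)–(3); [SteinWuthrich2013] §3.
-/

-- the summit namespace repeats `BirchSwinnertonDyer` by design (summit = problem); linter moot
set_option linter.dupNamespace false
set_option autoImplicit false

noncomputable section

namespace Summit.BirchSwinnertonDyer.BirchSwinnertonDyer.Theorems.AnalyticMuTwo

open Filter Topology
open scoped MatrixGroups ModularForm fwdDiff

open CongruenceSubgroup Literature.NumberTheory.EllipticCurves Literature.NumberTheory.EllipticCurves.ModularForms

/-! ### §2 The orbit sums and the odd classes at `p = 2` -/

section Orbit

variable {N : ℕ} [NeZero N] (f : CuspForm (Gamma0 N) 2)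

/-- The `2`-adic roots of unity of order dividing `torsionOrder 2 = 2` are `±1`. [folklore] -/
private theorem coe_rootsOfUnity_torsionOrder_two (ξ : rootsOfUnity (torsionOrder 2) ℤ_[2]) :
    ((ξ : ℤ_[2]ˣ) : ℤ_[2]) = 1 ∨ ((ξ : ℤ_[2]ˣ) : ℤ_[2]) = -1 := by
  obtain ⟨u, hu⟩ := ξ
  rw [mem_rootsOfUnity, torsionOrder_two] at hu
  have h' : ((u : ℤ_[2])) ^ 2 = 1 := by
    rw [← Units.val_pow_eq_pow_val, hu, Units.val_one]
  exact sq_eq_one_iff.mp h'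

/-- **The Teichmüller-orbit sum at `p = 2` is the DOUBLED ball value**:
`∑_{ξ = ±1} μ_{f,α}(ξ·5ˢ + 2ᵐ⁺²ℤ₂) = 2·μ_{f,α}(5ˢ + 2ᵐ⁺²ℤ₂)` (`msdMeasure_neg`: the measure is even).  Same
computation as `padicLRiemannSum_two`. [cite: MazurTateTeitelbaum1986Invent, §I.13 (p = 2: Δ = {±1}, γ = 5)] -/
theorem orbitSum_two_eq (α : ℚ_[2]) (m : ℕ) (s : ZMod (2 ^ m)) :
    (∑ᶠ ξ : rootsOfUnity (torsionOrder 2) ℤ_[2],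
      msdMeasure f α (m + cyclotomicExponent 2)
        (PadicInt.toZModPow (m + cyclotomicExponent 2) ((ξ : ℤ_[2]ˣ) : ℤ_[2]) *
          (cyclotomicGenerator 2 : ZMod (2 ^ (m + cyclotomicExponent 2))) ^ s.val)) =
      2 * msdMeasure f α (m + 2) ((cyclotomicGenerator 2 : ZMod (2 ^ (m + 2))) ^ s.val) := by
  classical
  set G : ℤ_[2] → ℚ_[2] := fun u ↦
    msdMeasure f α (m + 2) (PadicInt.toZModPow (m + 2) u *
        (cyclotomicGenerator 2 : ZMod (2 ^ (m + 2))) ^ s.val) with hG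
  have hG1 : G 1 = msdMeasure f α (m + 2) ((cyclotomicGenerator 2 : ZMod (2 ^ (m + 2))) ^ s.val) := by
    simp only [hG, map_one, one_mul]
  have hGneg : G (-1) = G 1 := by
    simp only [hG, map_neg, map_one, neg_one_mul, one_mul, msdMeasure_neg]
  have hζmem : (-1 : ℤ_[2]ˣ) ∈ rootsOfUnity (torsionOrder 2) ℤ_[2] := by
    rw [mem_rootsOfUnity, torsionOrder_two]; norm_num
  set ζ : rootsOfUnity (torsionOrder 2) ℤ_[2] := ⟨-1, hζmem⟩ with hζ
  have hne : (1 : rootsOfUnity (torsionOrder 2) ℤ_[2]) ≠ ζ := by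
    intro h
    have h' : (((1 : rootsOfUnity (torsionOrder 2) ℤ_[2]) : ℤ_[2]ˣ) : ℤ_[2]) = ((ζ : ℤ_[2]ˣ) : ℤ_[2]) := by
      rw [h]
    rw [hζ] at h'
    simp only [OneMemClass.coe_one, Units.val_one, Units.val_neg] at h'
    have h2 : (2 : ℤ_[2]) = 0 := by linear_combination h'
    exact two_ne_zero h2
  haveI := neZero_torsionOrder 2
  haveI : Fintype (rootsOfUnity (torsionOrder 2) ℤ_[2]) := Fintype.ofFinite _
  have huniv : (Finset.univ : Finset (rootsOfUnity (torsionOrder 2) ℤ_[2])) = {1, ζ} := by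
    ext ξ
    simp only [Finset.mem_univ, Finset.mem_insert, Finset.mem_singleton, true_iff]
    rcases coe_rootsOfUnity_torsionOrder_two ξ with h | h
    · left
      exact Subtype.ext (Units.ext (by simpa using h))
    · right
      exact Subtype.ext (Units.ext (by rw [hζ]; simpa using h))
  have hLHS : (∑ᶠ ξ : rootsOfUnity (torsionOrder 2) ℤ_[2],
      msdMeasure f α (m + cyclotomicExponent 2)
        (PadicInt.toZModPow (m + cyclotomicExponent 2) ((ξ : ℤ_[2]ˣ) : ℤ_[2]) *
          (cyclotomicGenerator 2 : ZMod (2 ^ (m + cyclotomicExponent 2))) ^ s.val)) =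
      ∑ᶠ ξ : rootsOfUnity (torsionOrder 2) ℤ_[2], G ((ξ : ℤ_[2]ˣ) : ℤ_[2]) := rfl
  rw [hLHS, finsum_eq_sum_of_fintype, huniv, Finset.sum_pair hne]
  simp only [OneMemClass.coe_one, Units.val_one, hζ, Units.val_neg]
  rw [hGneg, hG1, two_mul]

/-- **Every ODD class modulo `2ⁿ⁺²` is `±5ˢ`**, so its measure is an orbit value:
`μ_{f,α}(b) = μ_{f,α}(5ˢ)` for some `s mod 2ⁿ` (the bijection `{±1} × ℤ/2ⁿ → (ℤ/2ⁿ⁺²)ˣ`, `(ξ,s) ↦ ξ·5ˢ`,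
`classMap_injective` / `card_classDomain`; evenness `msdMeasure_neg`).
[cite: MazurTateTeitelbaum1986Invent, §I.13 (p = 2: Δ = {±1}, γ = 5)] [cite: Washington1997, §7.2] -/
theorem exists_orbit_eq_of_odd (α : ℚ_[2]) {n : ℕ} {b : ZMod (2 ^ (n + 2))} (hb : ¬ 2 ∣ b.val) :
    ∃ s : ZMod (2 ^ n), msdMeasure f α (n + 2) ((cyclotomicGenerator 2 : ZMod (2 ^ (n + 2))) ^ s.val) =
      msdMeasure f α (n + 2) b := by
  classical
  haveI := neZero_torsionOrder 2
  haveI : Fintype (rootsOfUnity (torsionOrder 2) ℤ_[2]) := Fintype.ofFinite _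
  haveI : NeZero (2 ^ (n + 2)) := ⟨pow_ne_zero _ two_ne_zero⟩
  -- `b` is a unit
  have hbu : IsUnit b := by
    have hcop : Nat.Coprime b.val (2 ^ (n + 2)) :=
      (Nat.Coprime.pow_left (n + 2) ((Nat.Prime.coprime_iff_not_dvd Nat.prime_two).mpr hb)).symm
    have h := (ZMod.isUnit_iff_coprime b.val (2 ^ (n + 2))).mpr hcop
    rwa [ZMod.natCast_zmod_val] at h
  -- the bijection `(ξ, s) ↦ ξ·γ^s`
  set Φ : rootsOfUnity (torsionOrder 2) ℤ_[2] × ZMod (2 ^ n) →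
      (ZMod (2 ^ (n + cyclotomicExponent 2)))ˣ := fun x ↦ (isUnit_classMap 2 n x).unit with hΦ_def
  have hΦval : ∀ x, (Φ x : ZMod (2 ^ (n + cyclotomicExponent 2))) =
      PadicInt.toZModPow (n + cyclotomicExponent 2) ((x.1 : ℤ_[2]ˣ) : ℤ_[2]) *
        (cyclotomicGenerator 2 : ZMod (2 ^ (n + cyclotomicExponent 2))) ^ x.2.val := fun x ↦
    IsUnit.unit_spec _
  have hΦinj : Function.Injective Φ := fun x y hxy ↦ classMap_injective 2 n (by
    have h := congr_arg Units.val hxy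
    rwa [hΦval, hΦval] at h)
  have hΦbij : Function.Bijective Φ :=
    (Fintype.bijective_iff_injective_and_card Φ).mpr ⟨hΦinj, card_classDomain 2 n⟩
  obtain ⟨⟨ξ, s⟩, hx⟩ := hΦbij.2 hbu.unit
  refine ⟨s, ?_⟩
  have hval : PadicInt.toZModPow (n + 2) ((ξ : ℤ_[2]ˣ) : ℤ_[2]) *
      (cyclotomicGenerator 2 : ZMod (2 ^ (n + 2))) ^ s.val = b := by
    have h := congr_arg Units.val hx
    rw [hΦval, IsUnit.unit_spec] at h
    exact h
  rcases coe_rootsOfUnity_torsionOrder_two ξ with h1 | h1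
  · rw [h1, map_one, one_mul] at hval
    rw [hval]
  · rw [h1, map_neg, map_one, neg_one_mul] at hval
    rw [← hval, msdMeasure_neg]

end Orbit

/-! ### §3 The Riemann sums on the exponent line: regrouping, the Lucas congruence, the certificate -/

section Certificate

variable {N : ℕ} [NeZero N] (f : CuspForm (Gamma0 N) 2) (α : ℚ_[2])

/-- `RS(k, m) = ∑_{s mod 2ᵐ} ν_m(s)·(s choose k)` with the DOUBLED values `ν_m(s) = 2μ_{f,α}(5ˢ + 2ᵐ⁺²ℤ₂)`
(`padicLRiemannSum_two`). [cite: MazurTateTeitelbaum1986Invent, §I.13 (p = 2: Δ = {±1}, γ = 5)] -/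
theorem padicLRiemannSum_two_eq_sum (k m : ℕ) :
    padicLRiemannSum f α k m = ∑ s : ZMod (2 ^ m),
      (2 * msdMeasure f α (m + 2) ((cyclotomicGenerator 2 : ZMod (2 ^ (m + 2))) ^ s.val)) *
        ((s.val.choose k : ℕ) : ℚ_[2]) := by
  rw [padicLRiemannSum_two, Finset.mul_sum]
  refine Finset.sum_congr rfl fun s _ ↦ ?_
  ring

/-- **Distribution relation of the doubled values on the exponent line**:
`∑_{s' ≡ s (2ᵐ)} ν_{m+1}(s') = ν_m(s)` (the orbit-sum relation `sum_fiber_orbitSum_succ_eq` of bsd-print-x9,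
read through `orbitSum_two_eq`). [cite: MazurTateTeitelbaum1986Invent, §I.11–I.13] -/
theorem sum_fiber_two_mul_msdMeasure_succ_eq
    (hdist : ∀ (n : ℕ) (a : ZMod (2 ^ n)),
      ∑ b ∈ Finset.univ.filter (fun b : ZMod (2 ^ (n + 1)) ↦
        ZMod.castHom (pow_dvd_pow 2 n.le_succ) (ZMod (2 ^ n)) b = a), msdMeasure f α (n + 1) b =
        msdMeasure f α n a)
    (m : ℕ) (s : ZMod (2 ^ m)) :
    ∑ s' ∈ Finset.univ.filter (fun s' : ZMod (2 ^ (m + 1)) ↦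
        ZMod.castHom (pow_dvd_pow 2 m.le_succ) (ZMod (2 ^ m)) s' = s),
      2 * msdMeasure f α (m + 1 + 2) ((cyclotomicGenerator 2 : ZMod (2 ^ (m + 1 + 2))) ^ s'.val) =
      2 * msdMeasure f α (m + 2) ((cyclotomicGenerator 2 : ZMod (2 ^ (m + 2))) ^ s.val) := by
  have h := sum_fiber_orbitSum_succ_eq (p := 2) (μ := msdMeasure f α) hdist m s
  rw [orbitSum_two_eq] at h
  rw [← h]
  refine Finset.sum_congr rfl fun s' _ ↦ ?_
  rw [orbitSum_two_eq]

/-- **The Lucas congruence of the `2`-adic Riemann sums**: for `k < 2ⁿ ≤ 2ᵐ`, `‖RS(k,m) − RS(k,n)‖₂ ≤ ½`,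
granted the distribution relation of `μ_{f,α}` and `‖μ_{f,α}‖ ≤ 2` (so `‖ν‖ ≤ 1`).  One step `m → m+1`:
regroup `RS(k,m)` over the fibres of `ℤ/2ᵐ⁺¹ → ℤ/2ᵐ`; a class contributes `ν_{m+1}(s')·((s' choose k) −
(s' mod 2ᵐ choose k))`, of norm `≤ ½` by Lucas. [cite: MazurTateTeitelbaum1986Invent, §I.12–I.13]
[cite: SteinWuthrich2013, §3] -/
theorem norm_padicLRiemannSum_two_sub_le_half
    (hdist : ∀ (n : ℕ) (a : ZMod (2 ^ n)),
      ∑ b ∈ Finset.univ.filter (fun b : ZMod (2 ^ (n + 1)) ↦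
        ZMod.castHom (pow_dvd_pow 2 n.le_succ) (ZMod (2 ^ n)) b = a), msdMeasure f α (n + 1) b =
        msdMeasure f α n a)
    (hμ : ∀ (m : ℕ) (a : ZMod (2 ^ m)), ‖msdMeasure f α m a‖ ≤ 2)
    {k n : ℕ} (hk : k < 2 ^ n) {m : ℕ} (hnm : n ≤ m) :
    ‖padicLRiemannSum f α k m - padicLRiemannSum f α k n‖ ≤ 2⁻¹ := by
  classical
  have h2norm : ‖(2 : ℚ_[2])‖ = 2⁻¹ := by simpa using Padic.norm_p (p := 2)
  have hν : ∀ (m : ℕ) (a : ZMod (2 ^ (m + 2))), ‖2 * msdMeasure f α (m + 2) a‖ ≤ 1 := by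
    intro m a
    rw [norm_mul, h2norm]
    calc (2 : ℝ)⁻¹ * ‖msdMeasure f α (m + 2) a‖ ≤ 2⁻¹ * 2 := by gcongr; exact hμ _ _
      _ = 1 := by norm_num
  -- one step
  have hstep : ∀ m : ℕ, k < 2 ^ m →
      ‖padicLRiemannSum f α k (m + 1) - padicLRiemannSum f α k m‖ ≤ 2⁻¹ := by
    intro m hkm
    haveI : NeZero (2 ^ m) := ⟨pow_ne_zero _ two_ne_zero⟩
    haveI : NeZero (2 ^ (m + 1)) := ⟨pow_ne_zero _ two_ne_zero⟩
    set π : ZMod (2 ^ (m + 1)) → ZMod (2 ^ m) :=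
      fun s' ↦ ZMod.castHom (pow_dvd_pow 2 m.le_succ) (ZMod (2 ^ m)) s' with hπ
    have hπval : ∀ s' : ZMod (2 ^ (m + 1)), (π s').val = s'.val % 2 ^ m := by
      intro s'
      rw [hπ]
      dsimp only
      rw [ZMod.castHom_apply, ZMod.cast_eq_val, ZMod.val_natCast]
    -- regroup `RS(k, m)` over the fibres
    have hRSm : padicLRiemannSum f α k m = ∑ s' : ZMod (2 ^ (m + 1)),
        (2 * msdMeasure f α (m + 1 + 2) ((cyclotomicGenerator 2 : ZMod (2 ^ (m + 1 + 2))) ^ s'.val)) *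
          (((π s').val.choose k : ℕ) : ℚ_[2]) := by
      rw [padicLRiemannSum_two_eq_sum]
      rw [← Finset.sum_fiberwise (Finset.univ : Finset (ZMod (2 ^ (m + 1)))) π]
      refine Finset.sum_congr rfl fun s _ ↦ ?_
      rw [← sum_fiber_two_mul_msdMeasure_succ_eq f α hdist m s, Finset.sum_mul]
      refine Finset.sum_congr rfl fun s' hs' ↦ ?_
      have hs'' : π s' = s := (Finset.mem_filter.mp hs').2
      rw [hs'']
    rw [hRSm, padicLRiemannSum_two_eq_sum, ← Finset.sum_sub_distrib]
    refine IsUltrametricDist.norm_sum_le_of_forall_le_of_nonneg (by norm_num) fun s' _ ↦ ?_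
    rw [← mul_sub, norm_mul]
    have hL : ‖((s'.val.choose k : ℕ) : ℚ_[2]) - (((π s').val.choose k : ℕ) : ℚ_[2])‖ ≤ 2⁻¹ := by
      rw [hπval]
      exact norm_natCast_choose_sub_choose_le_half (Nat.mod_modEq _ _).symm hkm
    calc _ ≤ 1 * 2⁻¹ := mul_le_mul (hν _ _) hL (norm_nonneg _) zero_le_one
      _ = 2⁻¹ := one_mul _
  -- telescope
  induction m, hnm using Nat.le_induction with
  | base =>
    rw [sub_self, norm_zero]
    norm_num
  | succ m hnm ih =>
    have hkm : k < 2 ^ m := hk.trans_le (Nat.pow_le_pow_right two_pos hnm)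
    calc ‖padicLRiemannSum f α k (m + 1) - padicLRiemannSum f α k n‖
        = ‖(padicLRiemannSum f α k (m + 1) - padicLRiemannSum f α k m) +
            (padicLRiemannSum f α k m - padicLRiemannSum f α k n)‖ := by rw [sub_add_sub_cancel]
      _ ≤ max ‖padicLRiemannSum f α k (m + 1) - padicLRiemannSum f α k m‖
            ‖padicLRiemannSum f α k m - padicLRiemannSum f α k n‖ :=
          IsUltrametricDist.norm_add_le_max _ _
      _ ≤ 2⁻¹ := max_le (hstep m hkm) ih

/-- **THE `μ = 0` CERTIFICATE AT `p = 2` (orbit form).**  Let `f` be a weight-2 cusp form on `Γ₀(N)` and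
`α ∈ ℚ₂` such that `μ_{f,α}` satisfies the distribution relation and `‖μ_{f,α}‖ ≤ 2`, and suppose every
coefficient of `L₂(f, α, T)` is `2`-integral (INT2-AUTO).  If ONE doubled value
`ν_n(s₀) = 2μ_{f,α}(5^{s₀} + 2ⁿ⁺²ℤ₂)` is a `2`-adic UNIT, then some coefficient `c_k`, `k < 2ⁿ`, is a unit:
`‖c_k‖₂ = 1` — the `μ`-invariant of `L₂(f, α, T)` vanishes.  Proof: otherwise all `c_k`, `k < 2ⁿ`, are even,
hence (`‖c_k − RS(k,n)‖ ≤ ½`, Lucas + convergence `tendsto_padicLRiemannSum_of_norm_le`) all `RS(k,n)`,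
`k < 2ⁿ`, are even, and Newton inversion makes every `ν_n(s)` even.
[cite: MazurTateTeitelbaum1986Invent, §I.11–I.13] [cite: GreenbergVatsal2000, pp. 3–4, (2)–(3) (definition of μ^anal; transcribed as a predicate)] -/
theorem exists_norm_padicLCoeff_two_eq_one_of_orbit
    (hdist : ∀ (n : ℕ) (a : ZMod (2 ^ n)),
      ∑ b ∈ Finset.univ.filter (fun b : ZMod (2 ^ (n + 1)) ↦
        ZMod.castHom (pow_dvd_pow 2 n.le_succ) (ZMod (2 ^ n)) b = a), msdMeasure f α (n + 1) b =
        msdMeasure f α n a)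
    (hμ : ∀ (m : ℕ) (a : ZMod (2 ^ m)), ‖msdMeasure f α m a‖ ≤ 2)
    (hc : ∀ k : ℕ, ‖padicLCoeff f α k‖ ≤ 1)
    {n : ℕ} {s₀ : ZMod (2 ^ n)}
    (hs₀ : ‖2 * msdMeasure f α (n + 2) ((cyclotomicGenerator 2 : ZMod (2 ^ (n + 2))) ^ s₀.val)‖ = 1) :
    ∃ k < 2 ^ n, ‖padicLCoeff f α k‖ = 1 := by
  classical
  by_contra hcon
  push Not at hcon
  -- all coefficients below `2ⁿ` are even
  have hc' : ∀ k < 2 ^ n, ‖padicLCoeff f α k‖ ≤ 2⁻¹ := by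
    intro k hk
    refine not_lt.mp fun hlt ↦ hcon k hk ?_
    exact norm_eq_one_of_inv_lt_of_le_one (p := 2) (by exact_mod_cast hlt) (hc k)
  -- hence all Riemann sums at level `n` below degree `2ⁿ` are even
  have hRS : ∀ k < 2 ^ n, ‖padicLRiemannSum f α k n‖ ≤ 2⁻¹ := by
    intro k hk
    have hlim : Tendsto (fun m ↦ padicLRiemannSum f α k m - padicLRiemannSum f α k n) atTop
        (𝓝 (padicLCoeff f α k - padicLRiemannSum f α k n)) :=
      (tendsto_padicLRiemannSum_of_norm_le hdist ⟨2, hμ⟩ k).sub tendsto_const_nhds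
    have herr : ‖padicLCoeff f α k - padicLRiemannSum f α k n‖ ≤ 2⁻¹ := by
      refine le_of_tendsto hlim.norm ?_
      filter_upwards [eventually_ge_atTop n] with m hm
      exact norm_padicLRiemannSum_two_sub_le_half f α hdist hμ hk hm
    calc ‖padicLRiemannSum f α k n‖
        = ‖padicLCoeff f α k + -(padicLCoeff f α k - padicLRiemannSum f α k n)‖ := by
          congr 1; ring
      _ ≤ max ‖padicLCoeff f α k‖ ‖-(padicLCoeff f α k - padicLRiemannSum f α k n)‖ :=
          Padic.nonarchimedean _ _
      _ ≤ 2⁻¹ := by rw [norm_neg]; exact max_le (hc' k hk) herr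
  -- Newton inversion: every doubled value at level `n` is even
  have hν := norm_le_of_forall_norm_sum_mul_choose_le_two
    (fun s : ZMod (2 ^ n) ↦
      2 * msdMeasure f α (n + 2) ((cyclotomicGenerator 2 : ZMod (2 ^ (n + 2))) ^ s.val))
    (B := 2⁻¹) (fun k hk ↦ by
      rw [← padicLRiemannSum_two_eq_sum]
      exact hRS k hk) s₀
  rw [hs₀] at hν
  norm_num at hν

/-- **THE `μ = 0` CERTIFICATE AT `p = 2` (odd-class form)**: the same conclusion from a unit doubled value
`2μ_{f,α}(b + 2ⁿ⁺²ℤ₂)` at ANY odd class `b` (`exists_orbit_eq_of_odd`) — the output shape of the collapse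
`ByReductionTypeAtTwoAnalyticMuCollapse.exists_odd_norm_two_mul_msdMeasure_eq_one`.
[cite: MazurTateTeitelbaum1986Invent, §I.11–I.13] -/
theorem exists_norm_padicLCoeff_two_eq_one_of_odd
    (hdist : ∀ (n : ℕ) (a : ZMod (2 ^ n)),
      ∑ b ∈ Finset.univ.filter (fun b : ZMod (2 ^ (n + 1)) ↦
        ZMod.castHom (pow_dvd_pow 2 n.le_succ) (ZMod (2 ^ n)) b = a), msdMeasure f α (n + 1) b =
        msdMeasure f α n a)
    (hμ : ∀ (m : ℕ) (a : ZMod (2 ^ m)), ‖msdMeasure f α m a‖ ≤ 2)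
    (hc : ∀ k : ℕ, ‖padicLCoeff f α k‖ ≤ 1)
    {n : ℕ} {b : ZMod (2 ^ (n + 2))} (hb : ¬ 2 ∣ b.val)
    (hunit : ‖2 * msdMeasure f α (n + 2) b‖ = 1) :
    ∃ k < 2 ^ n, ‖padicLCoeff f α k‖ = 1 := by
  obtain ⟨s, hs⟩ := exists_orbit_eq_of_odd f α hb
  exact exists_norm_padicLCoeff_two_eq_one_of_orbit f α hdist hμ hc (s₀ := s) (by rw [hs]; exact hunit)

end Certificate

end Summit.BirchSwinnertonDyer.BirchSwinnertonDyer.Theorems.AnalyticMuTwo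

end
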